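import Summits.ResolutionOfSingularities.ResolutionOfSingularities.Theorems.UniformWalkClasses
import Summits.ResolutionOfSingularities.ResolutionOfSingularities.Theorems.TightDefectStrongWalks
import HarnessLib

/-!
# UniformWalkKernels — §4.1–§4.4 of the decomp-res node «UniformWalks» (lens-5 g12 REBASED, sha256
00c8d33cfdb7c8ff; critic rows 67/72)

Kernels PROVED (no sorry), VERBATIM from the lens file: §4.1 degree bookkeeping along a run (`totalDegree_run_le`:
degrees `≤ 2^i · deg F`,
the input of the compactness port); §4.2 roots are not small (`pow_le_totalDegree_of_run`: only exponents `pᵉ ≤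
d` enter a slice);
§4.3 the slice calculus (`walksTerminate_iff_slices`, monotonicity, `sliceTerminate_of_lt_two`); §4.4 the
equivalences modulo the
classical ports (`sliceTerminate_iff_exists_unifBound`, `unifBound_iff_unifFin`, **`finiteFieldCriterion`**,
`walksTerminate_iff_certificates`).
Pieces and ports: `Theorems.UniformWalkClasses` (module docstring there = the node).  [WRITER NOTE (decomp-res writer g5): lens
`ne_zero_of_isolatedTop` is the tree's `TightDefectStrongWalks.ne_zero_of_isolatedTop` (same statement) and is
cited, not restated.]
(Sources: Hauser2010 §§F–G; CafureMatera2006; vandenDriesSchmidt1984.)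
-/

open CategoryTheory AlgebraicGeometry
open Literature.AlgebraicGeometry.Resolution
open Summit.ResolutionOfSingularities.ResolutionOfSingularities.Theorems
open Summit.ResolutionOfSingularities.ResolutionOfSingularities.Theorems.WeakOrderReduction
open Summit.ResolutionOfSingularities.ResolutionOfSingularities.Theorems.ForcedTowerClasses
open Summit.ResolutionOfSingularities.ResolutionOfSingularities.Theorems.TightDefectClasses
open Summit.ResolutionOfSingularities.ResolutionOfSingularities.Theorems.TightDefectStrongWalks (ne_zero_of_isolatedTop)

namespace Summit.ResolutionOfSingularities.ResolutionOfSingularities.Theorems.UniformWalks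

/-! ## §4 Kernels (PROVED, no sorry) -/

section Kernels

open MvPolynomial
open Literature.AlgebraicGeometry.Resolution.Hauser2010
open Literature.AlgebraicGeometry.Resolution.PointBlowup
open Literature.Barriers.ResolutionOfSingularities


/-! ### 4.1 Degree bookkeeping: the complexity along a run is bounded (the input of the compactness port) -/

section Degree

variable {σ : Type} {K : Type} [Field K]

/-- `deg (c·u^s) ≤ |s|`. [folklore] -/
theorem totalDegree_monomial_le_degree (s : σ →₀ ℕ) (c : K) :
    (monomial s c).totalDegree ≤ s.degree := by
  rw [Finsupp.degree_apply]
  exact totalDegree_monomial_le s c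

/-- `|v| ≤ deg F` for `v` in the support. [folklore] -/
theorem degree_le_totalDegree {F : MvPolynomial σ K} {v : σ →₀ ℕ} (hv : v ∈ F.support) :
    v.degree ≤ F.totalDegree := by
  rw [Finsupp.degree_apply]
  exact le_totalDegree hv

/-- **Chart transform at most doubles the degree**: `|d^| = (|d| − q) + (|d| − d_j) ≤ 2|d|`
(tree `PointBlowup.degree_chartExponent`). [folklore] -/
theorem totalDegree_chartTransform_le [DecidableEq σ] [Fintype σ] (q : ℕ) (j : σ) (F : MvPolynomial σ K) :
    (PointBlowup.chartTransform q j F).totalDegree ≤ 2 * F.totalDegree := by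
  classical
  unfold PointBlowup.chartTransform
  refine (MvPolynomial.totalDegree_finsetSum _ _).trans (Finset.sup_le fun d hd => ?_)
  refine (totalDegree_monomial_le_degree _ _).trans ?_
  rw [degree_chartExponent]
  have h := degree_le_totalDegree hd
  omega

/-- Substitutions by polynomials of degree `≤ 1` do not raise the total degree. [folklore] -/
theorem totalDegree_aeval_le_of_forall_le_one {τ : Type} (φ : σ → MvPolynomial τ K)
    (hφ : ∀ i, (φ i).totalDegree ≤ 1) (G : MvPolynomial σ K) :
    (MvPolynomial.aeval φ G).totalDegree ≤ G.totalDegree := by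
  classical
  rw [G.as_sum, map_sum]
  refine (MvPolynomial.totalDegree_finsetSum _ _).trans (Finset.sup_le fun e he => ?_)
  rw [MvPolynomial.aeval_monomial, MvPolynomial.algebraMap_eq]
  refine (MvPolynomial.totalDegree_mul _ _).trans ?_
  rw [MvPolynomial.totalDegree_C, zero_add, Finsupp.prod]
  refine (MvPolynomial.totalDegree_finsetProd _ _).trans ?_
  refine le_trans (Finset.sum_le_sum fun i _ => (MvPolynomial.totalDegree_pow _ _).trans
    (Nat.mul_le_mul_left _ (hφ i))) ?_
  simp only [mul_one]
  rw [← G.as_sum]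
  exact MvPolynomial.le_totalDegree he

/-- **Translation preserves the degree bound.** [folklore] -/
theorem totalDegree_translate_le (b : σ → K) (G : MvPolynomial σ K) :
    (PointBlowup.translate b G).totalDegree ≤ G.totalDegree := by
  classical
  unfold PointBlowup.translate
  refine totalDegree_aeval_le_of_forall_le_one _ (fun i => ?_) G
  refine (MvPolynomial.totalDegree_add _ _).trans (max_le ?_ ?_)
  · exact (MvPolynomial.totalDegree_X (R := K) i).le
  · rw [MvPolynomial.totalDegree_C]; exact Nat.zero_le _

/-- **Cleaning does not raise the degree.** [folklore] -/
theorem totalDegree_deletePthPowers_le (q : ℕ) (P : MvPolynomial σ K) :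
    (deletePthPowers q P).totalDegree ≤ P.totalDegree := by
  classical
  unfold deletePthPowers
  refine (MvPolynomial.totalDegree_finsetSum _ _).trans (Finset.sup_le fun d hd => ?_)
  refine (totalDegree_monomial_le_degree _ _).trans ?_
  exact degree_le_totalDegree (Finset.mem_filter.mp hd).1

/-- **One step at most doubles the degree**: `deg (step q j b s).F ≤ 2 · deg s.F`. [folklore] -/
theorem totalDegree_step_le [DecidableEq σ] [Fintype σ] [DecidableEq K] (q : ℕ) (j : σ) (b : σ → K)
    (s : State σ K) : (step q j b s).F.totalDegree ≤ 2 * s.F.totalDegree := by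
  change (deletePthPowers q (PointBlowup.translate b (PointBlowup.chartTransform q j s.F))).totalDegree ≤ _
  exact (totalDegree_deletePthPowers_le _ _).trans
    ((totalDegree_translate_le _ _).trans (totalDegree_chartTransform_le _ _ _))

/-- **The complexity along a run is bounded**: `deg (st i).F ≤ 2^i · deg s₀.F` for `i ≤ B` — the states of the runs of
length `B` from roots of degree `≤ d` form a BOUNDED-DEGREE family (first-order in the field; finite over a finite
field). [folklore] -/
theorem totalDegree_run_le [DecidableEq σ] [Fintype σ] [DecidableEq K] {q : ℕ} {s₀ : State σ K} {B : ℕ}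
    (R : ForcedRun q s₀ B) :
    ∀ i, i ≤ B → (R.st i).F.totalDegree ≤ 2 ^ i * s₀.F.totalDegree := by
  intro i
  induction i with
  | zero => intro _; rw [R.st_zero]; simp
  | succ n ih =>
    intro hn
    rw [R.st_succ n (Nat.lt_of_succ_le hn), pow_succ]
    refine (totalDegree_step_le _ _ _ _).trans ?_
    have := ih (Nat.le_of_succ_le hn)
    calc 2 * (R.st n).F.totalDegree ≤ 2 * (2 ^ n * s₀.F.totalDegree) := Nat.mul_le_mul_left 2 this
      _ = 2 ^ n * 2 * s₀.F.totalDegree := by ring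

end Degree

/-! ### 4.2 Roots are not small: each degree slice involves finitely many exponents `pᵉ ≤ d` -/

section Root

variable {K : Type} [Field K] [DecidableEq K]

omit [DecidableEq K] in
/-- A non-zero root of exponent `q` has total degree `≥ q` (all its monomials have degree `≥ ord₀ F ≥ q`). [folklore] -/
theorem le_totalDegree_of_isRoot {q : ℕ} {s : State (Fin 3) K} (hs : IsRoot q s) (hF : s.F ≠ 0) :
    q ≤ s.F.totalDegree := by
  obtain ⟨d, hd⟩ := MvPolynomial.ne_zero_iff.mp hF
  have h1 := ordZero_le_of_coeff_ne_zero s.F d hd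
  have h2 : ((q : ℕ) : ℕ∞) ≤ ((d.degree : ℕ) : ℕ∞) := hs.2.2.trans h1
  have h3 : q ≤ d.degree := by exact_mod_cast h2
  exact h3.trans (degree_le_totalDegree (MvPolynomial.mem_support_iff.mpr hd))

/-- **Finitely many exponents per slice**: a root of degree `≤ d` that starts a forced run of positive length has
`pᵉ ≤ d`. [folklore] -/
theorem pow_le_totalDegree_of_run {p e d B : ℕ} {s₀ : State (Fin 3) K} (hs : IsRoot (p ^ e) s₀)
    (hd : s₀.F.totalDegree ≤ d) (R : ForcedRun (p ^ e) s₀ (B + 1)) : p ^ e ≤ d := by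
  have h0 : IsolatedTop (p ^ e) (R.st 0).F := R.isolated 0 (Nat.succ_pos B)
  rw [R.st_zero] at h0
  exact (le_totalDegree_of_isRoot hs (ne_zero_of_isolatedTop h0)).trans hd

end Root

/-! ### 4.3 The slice calculus (pure logic over the typed objects) -/

open Literature.AlgebraicGeometry.Resolution.PointBlowup

/-- Slices are instances of the whole. [folklore] -/
theorem sliceTerminate_of_walksTerminate (h : WalksTerminate) (d : ℕ) : SliceTerminate d :=
  fun p hp e he K _ _ _ _ s₀ hs _ W => h p hp e he K s₀ hs W

/-- The whole is the conjunction of its degree slices (every polynomial has a total degree). [folklore] -/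
theorem walksTerminate_of_slices (h : ∀ d, SliceTerminate d) : WalksTerminate :=
  fun p hp e he K _ _ _ _ s₀ hs W => h s₀.F.totalDegree p hp e he K s₀ hs le_rfl W

/-- **EXACT: `WalksTerminate ⟺ ∀ d, SliceTerminate d`.** [folklore] -/
theorem walksTerminate_iff_slices : WalksTerminate ↔ ∀ d, SliceTerminate d :=
  ⟨sliceTerminate_of_walksTerminate, walksTerminate_of_slices⟩

/-- Slices are monotone: a larger degree bound is a stronger statement. [folklore] -/
theorem sliceTerminate_mono {d d' : ℕ} (hdd : d ≤ d') (h : SliceTerminate d') : SliceTerminate d :=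
  fun p hp e he K _ _ _ _ s₀ hs hd W => h p hp e he K s₀ hs (hd.trans hdd) W

/-- **The slices `d < 2` are vacuous** (`pᵉ ≥ 2` divides into the degree): PROVED bottom rungs of the degree
ladder. [folklore] -/
theorem sliceTerminate_of_lt_two {d : ℕ} (hd2 : d < 2) : SliceTerminate d := by
  intro p hp e he K _ _ _ _ s₀ hs hd W
  have h1 : p ^ e ≤ d := pow_le_totalDegree_of_run hs hd (runOf W (0 + 1))
  have h2 : 2 ≤ p ^ e := le_trans hp.two_le (Nat.le_self_pow (by omega) p)
  omega

/-- **Uniform ⟹ slice**: a uniform bound kills every infinite walk (truncate it). [folklore] -/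
theorem sliceTerminate_of_unifBound {d B : ℕ} (h : UnifBound d B) : SliceTerminate d :=
  fun p hp e he K _ _ _ _ s₀ hs hd W => h p hp e he K s₀ hs hd (runOf W (B + 1))

/-- `UnifBound` is monotone in the length … [folklore] -/
theorem unifBound_mono_length {d B B' : ℕ} (hBB : B ≤ B') (h : UnifBound d B) : UnifBound d B' :=
  fun p hp e he K _ _ _ _ s₀ hs hd R => h p hp e he K s₀ hs hd (R.restrict (by omega))

/-- … and antitone in the degree. [folklore] -/
theorem unifBound_mono_degree {d d' B : ℕ} (hdd : d ≤ d') (h : UnifBound d' B) : UnifBound d B :=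
  fun p hp e he K _ _ _ _ s₀ hs hd R => h p hp e he K s₀ hs (hd.trans hdd) R

/-- **All fields ⟹ finite fields** (instantiation). [folklore] -/
theorem unifFin_of_unifBound {d B : ℕ} (h : UnifBound d B) : UnifFin d B :=
  fun p hp e he K _ _ _ _ _ s₀ hs hd R => h p hp e he K s₀ hs hd R

/-- **Finite fields ⟹ bounded finite fields** (instantiation). [folklore] -/
theorem unifFinUpTo_of_unifFin {d B : ℕ} (h : UnifFin d B) (m : ℕ) : UnifFinUpTo d B m := by
  intro p hp e he K _ _ _ _ _ _ s₀ hs hd R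
  haveI : Finite K := Finite.of_fintype K
  exact h p hp e he K s₀ hs hd R

/-- `UnifFin` is monotone in the length. [folklore] -/
theorem unifFin_mono_length {d B B' : ℕ} (hBB : B ≤ B') (h : UnifFin d B) : UnifFin d B' :=
  fun p hp e he K _ _ _ _ _ s₀ hs hd R => h p hp e he K s₀ hs hd (R.restrict (by omega))

/-- `UnifFinUpTo` is antitone in the cardinality bound. [folklore] -/
theorem unifFinUpTo_mono_card {d B m m' : ℕ} (hmm : m ≤ m') (h : UnifFinUpTo d B m') : UnifFinUpTo d B m :=
  fun p hp e he K _ _ _ _ _ hK s₀ hs hd R => h p hp e he K (hK.trans hmm) s₀ hs hd R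

/-- **Pointwise finite-field piece ⟸ whole** (instantiation). [folklore] -/
theorem algWalksTerminate_of_walksTerminate (h : WalksTerminate) : AlgWalksTerminate :=
  fun p hp e he K _ _ _ _ _ s₀ hs W => h p hp e he K s₀ hs W

/-! ### 4.4 The equivalences modulo the classical ports -/

/-- **`SliceTerminate d ⟺ ∃ B, UnifBound d B`** modulo compactness (the node's one EQUIV layer). [folklore] -/
theorem sliceTerminate_iff_exists_unifBound (hC : CompactnessPort) (d : ℕ) :
    SliceTerminate d ↔ ∃ B, UnifBound d B := by
  constructor
  · intro h
    by_contra hne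
    exact hC d (fun B hB => hne ⟨B, hB⟩) h
  · rintro ⟨B, hB⟩
    exact sliceTerminate_of_unifBound hB

/-- **`UnifBound d B ⟺ UnifFin d B`** modulo specialisation (finite fields suffice for bounded runs). [folklore] -/
theorem unifBound_iff_unifFin (hS : SpecialisationPort) (d B : ℕ) : UnifBound d B ↔ UnifFin d B :=
  ⟨unifFin_of_unifBound, hS d B⟩

/-- **THE FINITE-FIELD CRITERION.**  Modulo the two classical ports, termination of ALL forced walks over ALL perfect
fields of characteristic `p` is EQUIVALENT to: at every degree, forced runs over FINITE fields are uniformly short.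
[folklore] -/
theorem finiteFieldCriterion (hC : CompactnessPort) (hS : SpecialisationPort) :
    WalksTerminate ↔ ∀ d, ∃ B, UnifFin d B := by
  rw [walksTerminate_iff_slices]
  refine forall_congr' fun d => ?_
  rw [sliceTerminate_iff_exists_unifBound hC]
  exact exists_congr fun B => unifBound_iff_unifFin hS d B

/-- **CERTIFICATES ⟹ termination** (Σ₁ form, sufficiency): finite checks at the effective field bound certify
the crux. [folklore] -/
theorem walksTerminate_of_certificates (hS : SpecialisationPort) (m₀ : ℕ → ℕ → ℕ)
    (hE : EffectivePortAt m₀) (h : ∀ d, ∃ B, UnifFinUpTo d B (m₀ d B)) :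
    WalksTerminate := by
  refine walksTerminate_of_slices fun d => ?_
  obtain ⟨B, hB⟩ := h d
  exact sliceTerminate_of_unifBound (hS d B (hE d B hB))

/-- **Termination ⟹ certificates exist** (necessity, only compactness needed): every degree has a bound that passes
every finite check. [folklore] -/
theorem certificates_of_walksTerminate (hC : CompactnessPort) (h : WalksTerminate) :
    ∀ d, ∃ B, ∀ m, UnifFinUpTo d B m := by
  intro d
  obtain ⟨B, hB⟩ := (sliceTerminate_iff_exists_unifBound hC d).mp (sliceTerminate_of_walksTerminate h d)
  exact ⟨B, unifFinUpTo_of_unifFin (unifFin_of_unifBound hB)⟩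

/-- **The certificate form of the criterion** (Σ₁, modulo the ports, for an EXPLICIT effective bound `m₀`, schema
`EffectivePortAt m₀`):
termination ⟺ every degree has a length bound certified by ONE finite check. [folklore] -/
theorem walksTerminate_iff_certificates (hC : CompactnessPort) (hS : SpecialisationPort) (m₀ : ℕ → ℕ → ℕ)
    (hE : EffectivePortAt m₀) :
    WalksTerminate ↔ ∀ d, ∃ B, UnifFinUpTo d B (m₀ d B) := by
  constructor
  · intro h d
    obtain ⟨B, hB⟩ := certificates_of_walksTerminate hC h d
    exact ⟨B, hB (m₀ d B)⟩
  · exact walksTerminate_of_certificates hS m₀ hE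

end Kernels

end Summit.ResolutionOfSingularities.ResolutionOfSingularities.Theorems.UniformWalks
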